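/- LEAD seat `ym-line-cbag-p1` (prover-ym-line-cbag-p1-g24-0), route `EguchiKawaiDirectionLadder` (ideator ym-idea-2, LINE 8),
crux K_A `TripleSmallBallMargin` (stmt-QuantumFields-27724), S7 (final form): the RANK-ROBUST ENTRYWISE RIGIDITY BOUND E_rob on
`U(n)` facing a fixed diagonal unitary, in the shape consumed by the within-block rigidity branch (LEAD's `…RigidityTransfer`, F4):
width seat w3's covering reduction `RankRobust.haar_rankRobust_le` composed with the LEAD's `entrywiseRigidity_holds` (S2).
Nothing here bears on the Yang–Mills mass gap (barrier-ledger line onto `EguchiKawaiBreakdown`). -/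
import Summits.QuantumFields.YangMills.Theorems.EguchiKawaiDirectionLadderEntrywiseRigidityCircle
import Summits.QuantumFields.YangMills.Theorems.EguchiKawaiDirectionLadderRankRobustReduction
import HarnessLib

/-!
# Route `EguchiKawaiDirectionLadder`, crux `TripleSmallBallMargin`: E_rob — rank-robust entrywise rigidity (S7, final form)

`haar_rankRobustRigidity_le`: for every `η > 0` there are `κ ≥ 1`, `C ≥ 0`, `N₀` such that for all `n ≥ N₀`, `q ≤ n`,
`0 < t ≤ 1/18` and every unit-modulus `d : Fin n → ℂ`:
`Haar{V ∈ U(n) : ∃ R, rank R ≤ q, Σ_{ij} |(diag(d) V − V diag(d) − R)_{ij}|² ≤ n t}`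
`  ≤ 33^{n²}(100/t²)^{qn} · exp(n²(C − η log(18t))) · ∏_{j<k} pairFactor (κ·18t) |d_j − d_k|²`.
PROOF: w3's `RankRobust.haar_rankRobust_le` with `D = diag(d)` reduces to the plain event `{‖DV − VD‖_F² ≤ 36 n t} = {S_R(D,V) ≤ 18t}`
(`ekAction_pair_eq_frobSq`), which `entrywiseRigidity_holds` bounds.
-/

set_option autoImplicit false

noncomputable section

open MeasureTheory
open scoped ENNReal
open Literature.Barriers.QuantumFields

namespace Summit.QuantumFields.YangMills.Theorems.EguchiKawaiDirectionLadder

open Literature.MathematicalPhysics.QuantumFieldTheory (haarProbability)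

variable {n : ℕ}

/-- The diagonal unitary with unit-modulus entries `d`. -/
def diagUnitary (d : Fin n → ℂ) (hd : ∀ i, ‖d i‖ = 1) : UN n :=
  ⟨Matrix.diagonal d, (Literature.MathematicalPhysics.QuantumLattice.diagonal_mem_unitaryGroup_iff d).mpr hd⟩

/-- Its matrix is `diag(d)`. -/
theorem coe_diagUnitary (d : Fin n → ℂ) (hd : ∀ i, ‖d i‖ = 1) :
    ((diagUnitary d hd : UN n) : Matrix (Fin n) (Fin n) ℂ) = Matrix.diagonal d := rfl

/-- **E_rob: rank-robust entrywise rigidity** (w3's covering reduction ∘ entrywise rigidity on the circle). -/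
theorem haar_rankRobustRigidity_le {η : ℝ} (hη : 0 < η) :
    ∃ κ : ℝ, 1 ≤ κ ∧ ∃ C : ℝ, 0 ≤ C ∧ ∃ N₀ : ℕ, ∀ n : ℕ, N₀ ≤ n → ∀ q : ℕ, q ≤ n → ∀ t : ℝ, 0 < t → t ≤ 1 / 18 →
      ∀ d : Fin n → ℂ, (∀ i, ‖d i‖ = 1) →
        haarProbability (UN n) {V : UN n | ∃ R : Matrix (Fin n) (Fin n) ℂ, R.rank ≤ q ∧
            ∑ i, ∑ j, ‖(Matrix.diagonal d * (V : Matrix (Fin n) (Fin n) ℂ) -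
              (V : Matrix (Fin n) (Fin n) ℂ) * Matrix.diagonal d - R) i j‖ ^ 2 ≤ n * t} ≤
          ENNReal.ofReal ((33 : ℝ) ^ (n * n) * (100 / t ^ 2) ^ (q * n)) *
            ENNReal.ofReal (Real.exp ((n : ℝ) ^ 2 * (C - η * Real.log (18 * t))) *
              ∏ j : Fin n, ∏ k ∈ Finset.Ioi j, pairFactor (κ * (18 * t)) (‖d j - d k‖ ^ 2)) := by
  obtain ⟨κ, hκ, C, hC, N₀, hE⟩ := entrywiseRigidity_holds η hη
  refine ⟨κ, hκ, C, hC, max N₀ 1, fun n hn q hq t ht ht18 d hd => ?_⟩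
  have hN₀ : N₀ ≤ n := (le_max_left _ _).trans hn
  have hnpos : 0 < n := (le_max_right _ _).trans hn
  have ht1 : t ≤ 1 := ht18.trans (by norm_num)
  have h18 : 0 < 18 * t := by positivity
  have h18' : 18 * t ≤ 1 := by linarith
  set D : UN n := diagUnitary d hd with hD
  have hDmat : (D : Matrix (Fin n) (Fin n) ℂ) = Matrix.diagonal d := rfl
  -- the robust event in w3's `frobSq` form
  have hset : {V : UN n | ∃ R : Matrix (Fin n) (Fin n) ℂ, R.rank ≤ q ∧
        ∑ i, ∑ j, ‖(Matrix.diagonal d * (V : Matrix (Fin n) (Fin n) ℂ) -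
          (V : Matrix (Fin n) (Fin n) ℂ) * Matrix.diagonal d - R) i j‖ ^ 2 ≤ n * t} =
      {V : UN n | ∃ R : Matrix (Fin n) (Fin n) ℂ, R.rank ≤ q ∧
        frobSq ((D : Matrix (Fin n) (Fin n) ℂ) * (V : Matrix (Fin n) (Fin n) ℂ) -
          (V : Matrix (Fin n) (Fin n) ℂ) * (D : Matrix (Fin n) (Fin n) ℂ) - R) ≤ (n : ℝ) * t} := by
    ext V; simp only [Set.mem_setOf_eq, hDmat, frobSq]
  rw [hset]
  refine (RankRobust.haar_rankRobust_le hq D ht ht1).trans ?_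
  gcongr
  -- the plain event is the pair action event at `18 t`
  have hplain : {V : UN n | frobSq ((D : Matrix (Fin n) (Fin n) ℂ) * (V : Matrix (Fin n) (Fin n) ℂ) -
        (V : Matrix (Fin n) (Fin n) ℂ) * (D : Matrix (Fin n) (Fin n) ℂ)) ≤ 36 * ((n : ℝ) * t)} =
      {V : UN n | ekAction (![D, V] : EKConfig 2 n) ≤ 18 * t} := by
    ext V
    simp only [Set.mem_setOf_eq, ekAction_pair_eq_frobSq hnpos]
    rw [div_le_iff₀ (by positivity : (0 : ℝ) < 2 * n)]
    constructor <;> intro h <;> linarith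
  rw [hplain]
  exact hE n hN₀ (18 * t) h18 h18' D d hDmat

end Summit.QuantumFields.YangMills.Theorems.EguchiKawaiDirectionLadder

end
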